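import Literature.ModelTheory.PseudofiniteFields.UniformBound

/-!
# `PairwiseCurvedTilingsLC` (crux stmt-MatrixMultiplication-17883), line LonelyTranslates —
stub D: a pointwise-finite first-order bound over pseudo-finite fields is uniform

Support lemma for the (conditional) refutation skeleton
`Cruxes/PairwiseCurvedTilingsLC/Lines/LonelyTranslates.lean`, step (4) "a uniform index": if in
every pseudo-finite field `K` (`[Field K] [CompatibleRing K] [Infinite K]`,
`K ⊨ finiteFieldTheory`) every tuple satisfies SOME formula `χ_N` of a sequence, then one `N`
bounds the index uniformly (`∃ n ≤ N, χ_n`; no monotonicity in `N` is assumed). This is the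
compactness theorem; it is proved in the Literature tree through a non-principal ultraproduct
of counterexamples and Łoś's theorem
(`Literature.ModelTheory.PseudofiniteFields.FiniteField.exists_uniform_bound_of_pseudoFinite`),
and restated here with the registered stub signature.
-/

set_option linter.dupNamespace false  -- `Summit.<S>.<S>.…` is the mandated namespace

namespace Summit.MatrixMultiplication.MatrixMultiplication.Theorems.PairwiseCurvedTilingsLC.Negative

open FirstOrder FirstOrder.Language FirstOrder.Ring
open Literature.ModelTheory.PseudofiniteFields

/-- STUB D of line LonelyTranslates (uniform bound by compactness): if in every pseudo-finite
field every tuple `v : α → K` satisfies some formula `χ_N` of the sequence `χ`, then there is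
one `N` such that every tuple of every pseudo-finite field satisfies some `χ_n` with `n ≤ N`.
Immediate from `FiniteField.exists_uniform_bound_of_pseudoFinite` (ultraproduct + Łoś; the
finiteness of `α` is not needed there). -/
theorem stub_uniform_bound {α : Type} [Finite α] (χ : ℕ → Language.ring.Formula α)
    (h : ∀ (K : Type) [Field K] [CompatibleRing K] [Infinite K], K ⊨ finiteFieldTheory →
      ∀ v : α → K, ∃ N, (χ N).Realize v) :
    ∃ N, ∀ (K : Type) [Field K] [CompatibleRing K] [Infinite K], K ⊨ finiteFieldTheory →
      ∀ v : α → K, ∃ n ≤ N, (χ n).Realize v :=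
  FiniteField.exists_uniform_bound_of_pseudoFinite χ h

end Summit.MatrixMultiplication.MatrixMultiplication.Theorems.PairwiseCurvedTilingsLC.Negative
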